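import Summits.Ventures.LatticeQCDFlow.Scaling.DominatedStarRegimeFreeAutocorrelation
import Literature.Probability.MarkovChains.LazyChainSpectrum

/-!
HONEST FRAMING: exact (Metropolis-corrected) sampling algorithms for lattice gauge theory; figures
of merit are autocorrelation/cost numbers at stated couplings and volumes; no continuum-physics
claim.

# DominatedStarRegimeFreeRelaxation — THE ABSOLUTE SPECTRAL GAP OF THE MAP-ASSISTED HOT-REFRESHED HUB NEEDS NO REGIME EITHER:
# THE EXACT HOT DRAW IS A PROJECTION, SO EVERY EIGENVALUE IS `≥ −1 + (1−t)w_0` AND `γ⋆ ≥ min{Gap, (1−t)w_0}`; HENCE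
# `γ⋆ ≥ p·min{ct/(3m), (1−t)w_0/(7K)}`, `t_rel ≤ 1/(p·min{…})` AND `t_mix(ε) ≤ ⌈t_rel·log(1/(2ε·π̃_min))⌉` FOR THE CHAPTER-M
# SCHEME WITH ENTRY MAPS AND NO `4t ≤ p(1−t)w_0` — OPEN-MATH ITEM 1 WITH THE VOLUME LOGARITHM IN PLACE OF `log K`
# (lean-2 GEN-28, ours)

Venture-side (OURS).  Cell `lqcd-flow` (pub-lqcd), unit `pub-lqcd-lean-2-g28`, 2026-08-28.  Chapter N, file 4.  Chapter M's
`Scaling/DominatedStarGapAndMixing` (M8) read `λ⋆ ≤ 1 − tcp/(2m)` off the distance profile, inside the regime.  Without the regime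
the variational gap of `Scaling/DominatedStarRegimeFreeGap` (N2) controls the top of the spectrum; the bottom is controlled by the
structure of the scheme: the exact hot draw `E_0` (coordinate `0` redrawn from `μ_0`) satisfies `⟨f, E_0 f⟩_π̃ = Σ_{rest} (E_0 f)² ≥ 0`,
i.e. `𝓔_{E_0}(f) ≤ ‖f‖²_π̃`, while every other piece of the scheme is a `π̃`-stationary transition matrix with `𝓔 ≤ 2‖f‖²_π̃`.  So
`𝓔_P(f) ≤ (2 − (1−t)w_0)·‖f‖²_π̃`, every eigenvalue is `≥ −1 + (1−t)w_0`, and `γ⋆ ≥ min{Gap, (1−t)w_0} = ` the N2 floor (which is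
`≤ (1−t)w_0/7`).  The relaxation time and Levin–Peres–Wilmer's Theorem 12.4 (in the tree) then give the regime-free ceilings.

## What is proved

* §0 (any finite chain) **`dirichletForm_le_two_mul_piInner`** — `𝓔_Q(f) ≤ 2‖f‖²_π` for a row-stochastic `Q` with `πQ = π`, `π ≥ 0`;
  **`absSpectralGap_ge_min_of_dirichletForm_le`** — reversible irreducible `P` (`π > 0`, `|X| ≥ 2`) with `𝓔_P(f) ≤ (2−h)‖f‖²_π` for
  all `f`: **`γ⋆ ≥ min{Gap(P), h}`** (every eigenvalue `λ_j ≠ 1` has `h − 1 ≤ λ_j ≤ 1 − Gap`).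
* §1 (the scheme) `coordKernel_rowStochastic`, `dirichletForm_prodKernel_eq_sum_coordKernel` (`𝓔_Π = Σ_k w_k 𝓔_{C_k}`),
  **`exactCoordKernel_dirichletForm_le_piInner`** (`𝓔_{E_0}(f) ≤ ‖f‖²_π̃`), **`dominatedStar_dirichletForm_le`**
  (`𝓔_P(f) ≤ (2 − (1−t)w_0)‖f‖²_π̃`; any edge-swap component, reversible cold kernels).
* §2 **`dominatedStar_absSpectralGap_ge_regimeFree`** — `γ⋆ ≥ p·min{ct/(3m), (1−t)w_0/(7K)}`;
  **`dominatedStar_relaxationTime_le_regimeFree`** — `t_rel ≤ 1/(p·min{ct/(3m), (1−t)w_0/(7K)})`;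
  **`dominatedStar_mixingTime_le_regimeFree`** — `t_mix(ε) ≤ ⌈(1/(p·min{ct/(3m), (1−t)w_0/(7K)}))·log(1/(2ε·π̃_min))⌉` for any
  `0 < π̃_min ≤ π̃`: all under M8's hypotheses with `4t ≤ p(1−t)w_0` replaced by `0 < t < 1`, `0 < w_0`.

Reading (no numerics implied): for every quadratic quantity (gap, absolute gap, relaxation time, `τ_int`) the regime of chapter M is
a bookkeeping artefact; what the regime still buys is the LOGARITHM: chapter M's `t_mix(ε) ≤ ⌈(2m/(tcp))·log((2K+p)/(pε))⌉` has
`log K`, the regime-free ceiling here has `log(1/π̃_min) = Σ_k log(1/min μ_k)` — the volume.  OPEN-MATH item 1 is exactly the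
replacement of that logarithm outside the regime.  NOT CLAIMED: any `log K` mixing bound outside the regime; sharp constants;
anything measured.  Literature grade (cell rule): OWN RESULT on N2/N3 and the tree's Levin–Peres–Wilmer §12.1–12.2
(`specFun`/`specVal`, `lambdaStar_eq_sup`, `secondEigenvalue_eq_sup`, Theorem 12.4); nothing cited as a fact; no new bib keys.
-/

noncomputable section

open Finset Function Matrix
open Literature.Probability.MarkovChains

namespace Summit.Ventures.LatticeQCDFlow.Scaling

/-! ## §0 Two facts about any finite chain -/

/-- **`𝓔_Q(f) ≤ 2‖f‖²_π`** for a row-stochastic `Q` with `πQ = π` and `π ≥ 0` (`(a−b)² ≤ 2a² + 2b²`, row sums, stationarity).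
[ours] -/
theorem dirichletForm_le_two_mul_piInner {X : Type*} [Fintype X] {π : X → ℝ} (hπ : ∀ x, 0 ≤ π x)
    {Q : Matrix X X ℝ} (hQ : IsRowStochastic Q) (hst : IsStationary π Q) (f : X → ℝ) :
    dirichletForm π Q f ≤ 2 * piInner π f f := by
  have hpt : ∀ x y, π x * Q x y * (f x - f y) ^ 2 ≤ π x * Q x y * (2 * (f x) ^ 2) + π x * Q x y * (2 * (f y) ^ 2) := by
    intro x y
    have h0 : 0 ≤ π x * Q x y := mul_nonneg (hπ x) (hQ.1 x y)
    nlinarith [mul_nonneg h0 (sq_nonneg (f x + f y))]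
  have h1 : ∑ x, ∑ y, π x * Q x y * (2 * (f x) ^ 2) = 2 * piInner π f f := by
    unfold piInner
    rw [mul_sum]
    refine sum_congr rfl fun x _ => ?_
    have e : ∑ y, π x * Q x y * (2 * (f x) ^ 2) = π x * (2 * (f x) ^ 2) * ∑ y, Q x y := by
      rw [mul_sum]; exact sum_congr rfl fun y _ => by ring
    rw [e, hQ.2 x]; ring
  have h2 : ∑ x, ∑ y, π x * Q x y * (2 * (f y) ^ 2) = 2 * piInner π f f := by
    unfold piInner
    rw [sum_comm, mul_sum]
    refine sum_congr rfl fun y _ => ?_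
    have e : ∑ x, π x * Q x y * (2 * (f y) ^ 2) = (∑ x, π x * Q x y) * (2 * (f y) ^ 2) := by rw [sum_mul]
    rw [e, hst y]; ring
  unfold dirichletForm
  calc 1 / 2 * ∑ x, ∑ y, π x * Q x y * (f x - f y) ^ 2
      ≤ 1 / 2 * ∑ x, ∑ y, (π x * Q x y * (2 * (f x) ^ 2) + π x * Q x y * (2 * (f y) ^ 2)) :=
        mul_le_mul_of_nonneg_left (sum_le_sum fun x _ => sum_le_sum fun y _ => hpt x y) (by norm_num)
    _ = 1 / 2 * (2 * piInner π f f + 2 * piInner π f f) := by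
        congr 1
        simp only [sum_add_distrib]
        rw [h1, h2]
    _ = 2 * piInner π f f := by ring

/-- **`𝓔_P ≤ (2−h)‖·‖²_π ⇒ γ⋆ ≥ min{Gap, h}`** for a reversible irreducible `P` w.r.t. a positive probability vector (`|X| ≥ 2`):
on the real eigenbasis every `λ_j ≠ 1` has `1 − λ_j = 𝓔_P(f_j) ≤ 2 − h` and `λ_j ≤ λ₂ = 1 − Gap`, so
`λ⋆ = max|λ_j| ≤ max{1 − Gap, 1 − h}`. [ours] -/
theorem absSpectralGap_ge_min_of_dirichletForm_le {X : Type*} [Fintype X] [DecidableEq X] [Nontrivial X] {π : X → ℝ}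
    (hπ : ∀ x, 0 < π x) (hπ1 : ∑ x, π x = 1) {P : Matrix X X ℝ} (hP : IsRowStochastic P) (hDB : DetailedBalance π P)
    (hirr : Literature.Probability.MarkovChains.IsIrreducible P) {h : ℝ}
    (hE : ∀ f : X → ℝ, dirichletForm π P f ≤ (2 - h) * piInner π f f) :
    min (spectralGap π P) h ≤ absSpectralGap P := by
  have hA := symmMatrix_isHermitian hπ hDB
  have hst : IsStationary π P := hDB.isStationary hP.2
  -- some `λ_j ≠ 1` exists
  have hmem := (isGreatest_orthEigenvalues hπ hπ1 hP hDB).1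
  rw [orthEigenvalues_eq hπ hπ1 hP hDB hirr hA] at hmem
  obtain ⟨j₀, hj₀, -⟩ := hmem
  have hne : (univ.filter (fun j => specVal hA j ≠ 1)).Nonempty := ⟨j₀, mem_filter.mpr ⟨mem_univ _, hj₀⟩⟩
  have hbound : ∀ j ∈ univ.filter (fun j => specVal hA j ≠ 1), |specVal hA j| ≤ 1 - min (spectralGap π P) h := by
    intro j hj
    rw [abs_le]
    constructor
    · -- `λ_j ≥ h − 1`
      have hEj := hE (specFun hA j)
      rw [dirichletForm_eq_of_eigen hP hst (mulVec_specFun hπ hA j), piInner_specFun hπ hA j j, if_pos rfl] at hEj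
      have hmin : min (spectralGap π P) h ≤ h := min_le_right _ _
      linarith
    · -- `λ_j ≤ λ₂ = 1 − Gap`
      have hle : specVal hA j ≤ secondEigenvalue π P := by
        rw [secondEigenvalue_eq_sup hπ hπ1 hP hDB hirr hA hne]
        exact le_sup' (fun j => specVal hA j) hj
      have e : secondEigenvalue π P = 1 - spectralGap π P := by unfold spectralGap; ring
      have hmin : min (spectralGap π P) h ≤ spectralGap π P := min_le_left _ _
      linarith
  have hsup := Finset.sup'_le hne (fun j => |specVal hA j|) hbound
  unfold absSpectralGap
  rw [lambdaStar_eq_sup hπ hA hne]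
  linarith

variable {S : Type*} [Fintype S] [DecidableEq S] {K m : ℕ} {μ : Fin (K + 1) → S → ℝ} {M : Fin (K + 1) → S → S → ℝ}
  {w : Fin (K + 1) → ℝ} {t p : ℝ}

/-! ## §1 The Dirichlet form of the scheme is at most `(2 − (1−t)w_0)·‖f‖²` -/

/-- A coordinate kernel of a transition matrix is a transition matrix. [ours] -/
theorem coordKernel_rowStochastic (hM : ∀ k, IsRowStochastic (M k)) (k : Fin (K + 1)) :
    IsRowStochastic (coordKernel M k : Matrix (Fin (K + 1) → S) (Fin (K + 1) → S) ℝ) := by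
  refine ⟨fun x y => coordKernel_nonneg M (fun j u v => (hM j).1 u v) k x y, fun x => ?_⟩
  have h := sum_coordKernel_mul M k x (fun _ => (1 : ℝ))
  simp only [mul_one] at h
  rw [h, (hM k).2]

/-- **`𝓔_π̃(Π_w^M; f) = Σ_k w_k·𝓔_π̃(C_k; f)`**, `C_k` the coordinate kernels. [ours] -/
theorem dirichletForm_prodKernel_eq_sum_coordKernel (f : (Fin (K + 1) → S) → ℝ) :
    dirichletForm (tensorFun μ) (prodKernel w M) f
      = ∑ k : Fin (K + 1), w k * dirichletForm (tensorFun μ) (coordKernel M k) f := by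
  unfold dirichletForm
  have e : ∀ x y : Fin (K + 1) → S, tensorFun μ x * prodKernel w M x y * (f x - f y) ^ 2
      = ∑ k : Fin (K + 1), w k * (tensorFun μ x * coordKernel M k x y * (f x - f y) ^ 2) := by
    intro x y
    rw [prodKernel_apply, mul_sum, sum_mul]
    exact sum_congr rfl fun k _ => by ring
  have e2 : ∑ x : Fin (K + 1) → S, ∑ y : Fin (K + 1) → S, tensorFun μ x * prodKernel w M x y * (f x - f y) ^ 2
      = ∑ k : Fin (K + 1), w k * ∑ x : Fin (K + 1) → S, ∑ y : Fin (K + 1) → S,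
          tensorFun μ x * coordKernel M k x y * (f x - f y) ^ 2 := by
    simp_rw [e]
    refine (Finset.sum_congr rfl fun x _ => Finset.sum_comm).trans ?_
    rw [Finset.sum_comm]
    refine Finset.sum_congr rfl fun k _ => ?_
    rw [Finset.mul_sum]
    exact Finset.sum_congr rfl fun x _ => by rw [Finset.mul_sum]
  rw [e2, Finset.mul_sum]
  exact Finset.sum_congr rfl fun k _ => by ring

/-- **THE EXACT HOT DRAW IS A PROJECTION: `𝓔_π̃(E_0; f) ≤ ‖f‖²_π̃`** (`E_0 =` the coordinate kernel redrawing coordinate `0` from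
`μ_0`): fiberwise over the cold coordinates it is a `μ_0`-variance, which is at most the `μ_0`-second moment. [ours] -/
theorem exactCoordKernel_dirichletForm_le_piInner (hμ : ∀ k x, 0 < μ k x) (hμ1 : ∀ k, ∑ u, μ k u = 1)
    (hM0 : ∀ u v, M 0 u v = μ 0 v) (f : (Fin (K + 1) → S) → ℝ) :
    dirichletForm (tensorFun μ) (coordKernel M 0) f ≤ piInner (tensorFun μ) f f := by
  set R : (Fin K → S) → ℝ := fun r => ∏ j : Fin K, μ j.succ (r j) with hR
  set F : S → (Fin K → S) → ℝ := fun a r => f (Fin.cons a r) with hF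
  have hR0 : ∀ r, 0 ≤ R r := fun r => prod_nonneg fun j _ => (hμ _ _).le
  -- the Dirichlet form in hot/cold coordinates
  have hE : dirichletForm (tensorFun μ) (coordKernel M 0) f
      = ∑ r : Fin K → S, R r * lawVariance (μ 0) (fun a => F a r) := by
    unfold dirichletForm
    have e1 : ∀ x : Fin (K + 1) → S, ∑ y, tensorFun μ x * coordKernel M 0 x y * (f x - f y) ^ 2
        = tensorFun μ x * ∑ v, μ 0 v * (f x - f (update x 0 v)) ^ 2 := by
      intro x
      simp_rw [mul_assoc]
      rw [← mul_sum, sum_coordKernel_mul M 0 x (fun y => (f x - f y) ^ 2)]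
      simp_rw [hM0]
    simp_rw [e1]
    rw [sum_state_eq_sum_cons]
    have e2 : ∀ (a : S) (r : Fin K → S), tensorFun μ (Fin.cons a r) * ∑ v, μ 0 v
        * (f (Fin.cons a r) - f (update (Fin.cons a r : Fin (K + 1) → S) 0 v)) ^ 2
        = R r * ∑ v, μ 0 a * μ 0 v * (F a r - F v r) ^ 2 := by
      intro a r
      rw [tensorFun_cons_succProd, mul_sum, mul_sum]
      refine sum_congr rfl fun v _ => ?_
      rw [Fin.update_cons_zero]
      simp only [hF, hR]
      ring
    simp_rw [e2]
    rw [sum_comm, mul_sum]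
    refine sum_congr rfl fun r _ => ?_
    rw [lawVariance_eq_half_sum (hμ1 0), ← mul_sum]
    have e3 : ∑ a, ∑ v, (F a r - F v r) ^ 2 * (μ 0 a * μ 0 v) = ∑ a, ∑ v, μ 0 a * μ 0 v * (F a r - F v r) ^ 2 :=
      sum_congr rfl fun a _ => sum_congr rfl fun v _ => by ring
    rw [e3]
    ring
  -- the second moment in hot/cold coordinates
  have hN : piInner (tensorFun μ) f f = ∑ r : Fin K → S, R r * ∑ a, μ 0 a * (F a r) ^ 2 := by
    unfold piInner
    rw [sum_state_eq_sum_cons, sum_comm]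
    refine sum_congr rfl fun r _ => ?_
    rw [mul_sum]
    refine sum_congr rfl fun a _ => ?_
    rw [tensorFun_cons_succProd]
    simp only [hF, hR]
    ring
  -- variance ≤ second moment, fiber by fiber
  have hfib : ∀ r : Fin K → S, lawVariance (μ 0) (fun a => F a r) ≤ ∑ a, μ 0 a * (F a r) ^ 2 := by
    intro r
    have h := piInner_sub_const_eq (hμ1 0) (fun a => F a r) 0
    simp only [sub_zero] at h
    unfold piInner at h
    have e : ∑ a, μ 0 a * (F a r) ^ 2 = ∑ a, μ 0 a * (F a r * F a r) := sum_congr rfl fun a _ => by ring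
    rw [e, h]
    nlinarith [sq_nonneg (lawMean (μ 0) (fun a => F a r) - 0)]
  rw [hE, hN]
  exact sum_le_sum fun r _ => mul_le_mul_of_nonneg_left (hfib r) (hR0 r)

/-- **`𝓔_P(f) ≤ (2 − (1−t)w_0)·‖f‖²_π̃` FOR THE SCHEME `P = t·Q + (1−t)·Π_w^M` WITH THE EXACT HOT SAMPLER** (`Q` any `π̃`-reversible
transition matrix — e.g. the map-assisted swap component —, cold kernels `μ_k`-reversible, `w ≥ 0`, `Σw = 1`, `0 ≤ t ≤ 1`). [ours] -/
theorem dominatedStar_dirichletForm_le {Q : Matrix (Fin (K + 1) → S) (Fin (K + 1) → S) ℝ} (hQ : IsRowStochastic Q)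
    (hQrev : DetailedBalance (tensorFun μ) Q) (ht0 : 0 ≤ t) (ht1 : t ≤ 1) (hw0 : ∀ k, 0 ≤ w k) (hw1 : ∑ k, w k = 1)
    (hμ : ∀ k x, 0 < μ k x) (hμ1 : ∀ k, ∑ u, μ k u = 1) (hM : ∀ k, IsRowStochastic (M k))
    (hMrev : ∀ k, DetailedBalance (μ k) (M k)) (hM0 : ∀ u v, M 0 u v = μ 0 v) (f : (Fin (K + 1) → S) → ℝ) :
    dirichletForm (tensorFun μ) (fun x y : Fin (K + 1) → S => t * Q x y + (1 - t) * prodKernel w M x y) f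
      ≤ (2 - (1 - t) * w 0) * piInner (tensorFun μ) f f := by
  have hπ0 : ∀ x, 0 ≤ tensorFun μ x := fun x => (tensorFun_pos hμ x).le
  set N : ℝ := piInner (tensorFun μ) f f with hNdef
  have hN0 : 0 ≤ N := sum_nonneg fun x _ => mul_nonneg (hπ0 x) (mul_self_nonneg _)
  have hQle : dirichletForm (tensorFun μ) Q f ≤ 2 * N :=
    dirichletForm_le_two_mul_piInner hπ0 hQ (hQrev.isStationary hQ.2) f
  have hCk : ∀ k, dirichletForm (tensorFun μ) (coordKernel M k) f ≤ 2 * N := fun k =>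
    dirichletForm_le_two_mul_piInner hπ0 (coordKernel_rowStochastic hM k)
      ((coordKernel_detailedBalance (π := μ) hMrev k).isStationary (coordKernel_rowStochastic hM k).2) f
  have hC0 : dirichletForm (tensorFun μ) (coordKernel M 0) f ≤ N := exactCoordKernel_dirichletForm_le_piInner hμ hμ1 hM0 f
  -- the product update: `Σ_k w_k 𝓔_{C_k} ≤ w_0·N + (1 − w_0)·2N`
  have hprod : dirichletForm (tensorFun μ) (prodKernel w M) f ≤ (2 - w 0) * N := by
    rw [dirichletForm_prodKernel_eq_sum_coordKernel, Fin.sum_univ_succ]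
    have hrest : ∑ k : Fin K, w k.succ * dirichletForm (tensorFun μ) (coordKernel M k.succ) f
        ≤ ∑ k : Fin K, w k.succ * (2 * N) :=
      sum_le_sum fun k _ => mul_le_mul_of_nonneg_left (hCk k.succ) (hw0 _)
    have hsum : ∑ k : Fin K, w k.succ = 1 - w 0 := by
      have h := hw1; rw [Fin.sum_univ_succ] at h; linarith
    have e : ∑ k : Fin K, w k.succ * (2 * N) = (1 - w 0) * (2 * N) := by rw [← sum_mul, hsum]
    have h0 : w 0 * dirichletForm (tensorFun μ) (coordKernel M 0) f ≤ w 0 * N := mul_le_mul_of_nonneg_left hC0 (hw0 0)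
    linarith [hrest, e.le, e.ge, h0]
  rw [weightedScheme_dirichletForm]
  have k1 : t * dirichletForm (tensorFun μ) Q f ≤ t * (2 * N) := mul_le_mul_of_nonneg_left hQle ht0
  have k2 : (1 - t) * dirichletForm (tensorFun μ) (prodKernel w M) f ≤ (1 - t) * ((2 - w 0) * N) :=
    mul_le_mul_of_nonneg_left hprod (by linarith)
  have e : t * (2 * N) + (1 - t) * ((2 - w 0) * N) = (2 - (1 - t) * w 0) * N := by ring
  linarith

section EntryStar
variable (κ : Fin m → Fin K) (φ : Fin m → Equiv.Perm S)

/-! ## §2 The regime-free absolute gap, relaxation time and mixing ceiling -/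

/-- **THE REGIME-FREE ABSOLUTE SPECTRAL GAP OF THE CHAPTER-M SCHEME: `γ⋆ ≥ p·min{ct/(3m), (1−t)w_0/(7K)}`** — exact hot sampler,
one-sided domination `p·μ_{κ_r+1}(φ_r u) ≤ μ_0(u)` (`0 < p ≤ 1`), reversible cold kernels, hub multiplicities `≥ c ≥ 1`, `0 < t < 1`,
`w_0 > 0`, `|S| ≥ 2`, `K ≥ 1`: the hypotheses of M8's `dominatedStar_absSpectralGap_ge` with `4t ≤ p(1−t)w_0` REMOVED. [ours] -/
theorem dominatedStar_absSpectralGap_ge_regimeFree [Nontrivial S] (hK : 1 ≤ K) (hm : 1 ≤ m) (ht0 : 0 < t) (ht1 : t < 1)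
    (hw0 : ∀ k, 0 ≤ w k) (hw00 : 0 < w 0) (hw1 : ∑ k, w k = 1) (hμ : ∀ k x, 0 < μ k x)
    (hμ1 : ∀ k, ∑ u, μ k u = 1) (hM : ∀ k, IsRowStochastic (M k)) (hMrev : ∀ k, DetailedBalance (μ k) (M k))
    (hM0 : ∀ u v, M 0 u v = μ 0 v) (hp0 : 0 < p) (hp1 : p ≤ 1) (hdom : ∀ r u, p * μ (κ r).succ (φ r u) ≤ μ 0 u)
    {c : ℕ} (hc1 : 1 ≤ c) (hc : ∀ p' : Fin K, c ≤ (univ.filter (fun r : Fin m => κ r = p')).card) :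
    p * min (c * t / (3 * m)) ((1 - t) * w 0 / (7 * K))
      ≤ absSpectralGap (fun y z : Fin (K + 1) → S =>
          t * ptGraphSwap μ (fun r : Fin m => (((0 : Fin (K + 1)), (κ r).succ) : Fin (K + 1) × Fin (K + 1))) φ y z
            + (1 - t) * prodKernel w M y z) := by
  have hKr : (1 : ℝ) ≤ K := by exact_mod_cast hK
  have h1t : 0 < 1 - t := by linarith
  have hgap := dominatedStar_spectralGap_ge_regimeFree κ φ hK hm ht0 ht1 hw0 hw00 hw1 hμ hμ1 hM hMrev hM0 hp0 hp1 hdom hc1 hc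
  have hmin := absSpectralGap_ge_min_of_dirichletForm_le (tensorFun_pos hμ) (sum_tensorFun_eq_one μ hμ1)
    (weightedScheme_isRowStochastic (ptGraphSwap_isRowStochastic hμ) hM hw0 hw1 ht0.le ht1.le)
    (weightedScheme_detailedBalance (ptGraphSwap_detailedBalance hμ) hMrev t)
    (dominatedStar_isIrreducible_regimeFree κ φ ht0 ht1 hw0 hw00 hw1 hμ hM hM0 hc1 hc)
    (h := (1 - t) * w 0)
    (fun f => dominatedStar_dirichletForm_le (ptGraphSwap_isRowStochastic hμ) (ptGraphSwap_detailedBalance hμ) ht0.le ht1.le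
      hw0 hw1 hμ hμ1 hM hMrev hM0 f)
  -- the N2 floor is below `(1−t)w_0`, so the minimum is the floor
  have hw01 : w 0 ≤ 1 := by
    have h := Finset.single_le_sum (f := w) (fun k _ => hw0 k) (mem_univ (0 : Fin (K + 1)))
    rw [hw1] at h; exact h
  have hle : p * min (c * t / (3 * m)) ((1 - t) * w 0 / (7 * K)) ≤ (1 - t) * w 0 := by
    have h1 : min (c * t / (3 * m)) ((1 - t) * w 0 / (7 * K)) ≤ (1 - t) * w 0 / (7 * K) := min_le_right _ _
    have h2 : (1 - t) * w 0 / (7 * K) ≤ (1 - t) * w 0 := by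
      rw [div_le_iff₀ (by positivity)]
      have : 0 ≤ (1 - t) * w 0 := by positivity
      nlinarith
    have h3 : 0 ≤ min (c * t / (3 * m)) ((1 - t) * w 0 / (7 * K)) := le_min (by positivity) (by positivity)
    calc p * min (c * t / (3 * m)) ((1 - t) * w 0 / (7 * K)) ≤ 1 * min (c * t / (3 * m)) ((1 - t) * w 0 / (7 * K)) :=
          mul_le_mul_of_nonneg_right hp1 h3
      _ ≤ (1 - t) * w 0 := by rw [one_mul]; exact h1.trans h2
  calc p * min (c * t / (3 * m)) ((1 - t) * w 0 / (7 * K))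
      ≤ min (spectralGap (tensorFun μ) (fun y z : Fin (K + 1) → S =>
          t * ptGraphSwap μ (fun r : Fin m => (((0 : Fin (K + 1)), (κ r).succ) : Fin (K + 1) × Fin (K + 1))) φ y z
            + (1 - t) * prodKernel w M y z)) ((1 - t) * w 0) := le_min hgap hle
    _ ≤ _ := hmin

/-- **THE REGIME-FREE RELAXATION TIME: `t_rel ≤ 1/(p·min{ct/(3m), (1−t)w_0/(7K)})`** (M8's `dominatedStar_relaxationTime_le`
without `4t ≤ p(1−t)w_0`). [ours] -/
theorem dominatedStar_relaxationTime_le_regimeFree [Nontrivial S] (hK : 1 ≤ K) (hm : 1 ≤ m) (ht0 : 0 < t) (ht1 : t < 1)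
    (hw0 : ∀ k, 0 ≤ w k) (hw00 : 0 < w 0) (hw1 : ∑ k, w k = 1) (hμ : ∀ k x, 0 < μ k x)
    (hμ1 : ∀ k, ∑ u, μ k u = 1) (hM : ∀ k, IsRowStochastic (M k)) (hMrev : ∀ k, DetailedBalance (μ k) (M k))
    (hM0 : ∀ u v, M 0 u v = μ 0 v) (hp0 : 0 < p) (hp1 : p ≤ 1) (hdom : ∀ r u, p * μ (κ r).succ (φ r u) ≤ μ 0 u)
    {c : ℕ} (hc1 : 1 ≤ c) (hc : ∀ p' : Fin K, c ≤ (univ.filter (fun r : Fin m => κ r = p')).card) :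
    relaxationTime (fun y z : Fin (K + 1) → S =>
        t * ptGraphSwap μ (fun r : Fin m => (((0 : Fin (K + 1)), (κ r).succ) : Fin (K + 1) × Fin (K + 1))) φ y z
          + (1 - t) * prodKernel w M y z) ≤ 1 / (p * min (c * t / (3 * m)) ((1 - t) * w 0 / (7 * K))) := by
  have hKr : (1 : ℝ) ≤ K := by exact_mod_cast hK
  have hmpos : (0 : ℝ) < m := Nat.cast_pos.mpr (by omega)
  have hcpos : (0 : ℝ) < c := Nat.cast_pos.mpr (by omega)
  have h1t : 0 < 1 - t := by linarith
  have hpos : 0 < p * min (c * t / (3 * m)) ((1 - t) * w 0 / (7 * K)) := mul_pos hp0 (lt_min (by positivity) (by positivity))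
  unfold relaxationTime
  exact one_div_le_one_div_of_le hpos
    (dominatedStar_absSpectralGap_ge_regimeFree κ φ hK hm ht0 ht1 hw0 hw00 hw1 hμ hμ1 hM hMrev hM0 hp0 hp1 hdom hc1 hc)

/-- **THE REGIME-FREE MIXING CEILING (VOLUME LOGARITHM): `t_mix(ε) ≤ ⌈(1/(p·min{ct/(3m), (1−t)w_0/(7K)}))·log(1/(2ε·π̃_min))⌉`**
for any `0 < π̃_min ≤ π̃(x)` (Levin–Peres–Wilmer Theorem 12.4 on the regime-free absolute gap).  Compare chapter M's
`⌈(2m/(tcp))·log((2K+p)/(pε))⌉` inside the regime: the rate survives without the regime, the `log K` does not (yet). [ours] -/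
theorem dominatedStar_mixingTime_le_regimeFree [Nontrivial S] (hK : 1 ≤ K) (hm : 1 ≤ m) (ht0 : 0 < t) (ht1 : t < 1)
    (hw0 : ∀ k, 0 ≤ w k) (hw00 : 0 < w 0) (hw1 : ∑ k, w k = 1) (hμ : ∀ k x, 0 < μ k x)
    (hμ1 : ∀ k, ∑ u, μ k u = 1) (hM : ∀ k, IsRowStochastic (M k)) (hMrev : ∀ k, DetailedBalance (μ k) (M k))
    (hM0 : ∀ u v, M 0 u v = μ 0 v) (hp0 : 0 < p) (hp1 : p ≤ 1) (hdom : ∀ r u, p * μ (κ r).succ (φ r u) ≤ μ 0 u)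
    {c : ℕ} (hc1 : 1 ≤ c) (hc : ∀ p' : Fin K, c ≤ (univ.filter (fun r : Fin m => κ r = p')).card)
    {πmin : ℝ} (hmin0 : 0 < πmin) (hmin : ∀ x, πmin ≤ tensorFun μ x) {ε : ℝ} (hε : 0 < ε) :
    mixingTime (fun y z : Fin (K + 1) → S =>
        t * ptGraphSwap μ (fun r : Fin m => (((0 : Fin (K + 1)), (κ r).succ) : Fin (K + 1) × Fin (K + 1))) φ y z
          + (1 - t) * prodKernel w M y z) (tensorFun μ) ε
      ≤ ⌈1 / (p * min (c * t / (3 * m)) ((1 - t) * w 0 / (7 * K))) * Real.log (1 / (2 * ε * πmin))⌉₊ := by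
  have hKr : (1 : ℝ) ≤ K := by exact_mod_cast hK
  have hmpos : (0 : ℝ) < m := Nat.cast_pos.mpr (by omega)
  have hcpos : (0 : ℝ) < c := Nat.cast_pos.mpr (by omega)
  have h1t : 0 < 1 - t := by linarith
  have hpos : 0 < p * min (c * t / (3 * m)) ((1 - t) * w 0 / (7 * K)) := mul_pos hp0 (lt_min (by positivity) (by positivity))
  have hgap := dominatedStar_absSpectralGap_ge_regimeFree κ φ hK hm ht0 ht1 hw0 hw00 hw1 hμ hμ1 hM hMrev hM0 hp0 hp1 hdom hc1 hc
  have hrel := dominatedStar_relaxationTime_le_regimeFree κ φ hK hm ht0 ht1 hw0 hw00 hw1 hμ hμ1 hM hMrev hM0 hp0 hp1 hdom hc1 hc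
  have hlam : lambdaStar (fun y z : Fin (K + 1) → S =>
      t * ptGraphSwap μ (fun r : Fin m => (((0 : Fin (K + 1)), (κ r).succ) : Fin (K + 1) × Fin (K + 1))) φ y z
        + (1 - t) * prodKernel w M y z) < 1 := by
    unfold absSpectralGap at hgap; linarith
  have hT := LevinPeres2017_thm_12_4 (tensorFun_pos hμ) (sum_tensorFun_eq_one μ hμ1)
    (weightedScheme_isRowStochastic (ptGraphSwap_isRowStochastic hμ) hM hw0 hw1 ht0.le ht1.le)
    (weightedScheme_detailedBalance (ptGraphSwap_detailedBalance hμ) hMrev t)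
    (dominatedStar_isIrreducible_regimeFree κ φ ht0 ht1 hw0 hw00 hw1 hμ hM hM0 hc1 hc) hlam hmin0 hmin hε
  by_cases hL : 0 ≤ Real.log (1 / (2 * ε * πmin))
  · exact hT.trans (Nat.ceil_mono (mul_le_mul_of_nonneg_right hrel hL))
  · push Not at hL
    have hrel0 : 0 ≤ relaxationTime (fun y z : Fin (K + 1) → S =>
        t * ptGraphSwap μ (fun r : Fin m => (((0 : Fin (K + 1)), (κ r).succ) : Fin (K + 1) × Fin (K + 1))) φ y z
          + (1 - t) * prodKernel w M y z) := by
      unfold relaxationTime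
      exact div_nonneg zero_le_one (le_trans hpos.le hgap)
    have h0 : ⌈relaxationTime (fun y z : Fin (K + 1) → S =>
        t * ptGraphSwap μ (fun r : Fin m => (((0 : Fin (K + 1)), (κ r).succ) : Fin (K + 1) × Fin (K + 1))) φ y z
          + (1 - t) * prodKernel w M y z) * Real.log (1 / (2 * ε * πmin))⌉₊ = 0 :=
      Nat.ceil_eq_zero.mpr (mul_nonpos_of_nonneg_of_nonpos hrel0 hL.le)
    rw [h0] at hT
    exact hT.trans (Nat.zero_le _)

end EntryStar

end Summit.Ventures.LatticeQCDFlow.Scaling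

end
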